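import Summits.ResolutionOfSingularities.ResolutionOfSingularities.Theorems.PurelyInseparableDim4JointLeafPointCharts
import HarnessLib

/-!
# Purely inseparable four-folds: computations for the MIXED instance — a 3-fold centre over which a SURFACE CHILD and an
# isolated LEAF POINT appear together (brick S3 (c) «joint point∘coordinate chains», part 30a, cell `res-dim4-pi`)

[OURS · counted 0] (D-0157 DOOR 2; desk WORD #66 (4)(c), #74 (g), #99 (d); frame `PIDim4.TerminationImpliesOrderReduction`,
S3 (c); host item stmt-ResolutionOfSingularities-16155, helper). Nothing here proves resolution of singularities in
dimension ≥ 4 / characteristic `p` — NOT here, not anywhere in this programme.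

`F = x₁^p · G`, `G = (x₂² − x₂)^p x₃ + (x₂x₃)^p x₄ + (x₂x₄)^p x₁ + x₁^p x₂`
`= x₂^{2p}x₃ − x₂^p x₃ + x₂^p x₃^p x₄ + x₁ x₂^p x₄^p + x₁^p x₂` (variables `x₁…x₄` = `X 0…X 3`), over `K` of characteristic `p`.
The closed order-`p` points of `z^p + F` form the 3-fold `{x₁ = 0}` (`roots_mixed`: `∂F/∂x₂ = x₁^{2p}`); in the chart `x₁` of its
blow-up the transform is `G` (`chartTransform_mixed`), whose equimultiple points on the exceptional hyperplane are
`{x₂ = 0} ∪ {(0, 1, 0, 0)}` (`cases_of_isEquimultiplePoint_mixed`: `∂G/∂x₃ = (x₂² − x₂)^p`, `∂G/∂x₄ = (x₂x₃)^p`, `∂G/∂x₁ = (x₂x₄)^p`)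
— a SURFACE CHILD `V(z, y₁, y₂)` (permissible for `G`, `isPermissibleCentre_pair_G_mixed`; dead: part 30a′) and an isolated LEAF.
The leaf's point blow-up is part 30b; the certificate is part 30c.

AI-produced formalisation, weaker than expert review. bears_on: LADDER-RESOLUTION:D157-DOOR2 (res-dim4-pi · S3 (c) joint v2 · mixed
instance, computations).
-/

set_option linter.dupNamespace false -- D-0017: single-problem summit path `Summit.<S>.<S>.…` by design

noncomputable section

open MvPolynomial Finset CategoryTheory AlgebraicGeometry Opposite TopologicalSpace

namespace Summit.ResolutionOfSingularities.ResolutionOfSingularities.Theorems.PIDim4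

open Literature.AlgebraicGeometry.Resolution
open Literature.AlgebraicGeometry.Resolution.Hauser2010
open Literature.AlgebraicGeometry.Resolution.AffinePointBlowup (P A γ coord Wtop ξ)

namespace Equimultiple

section Mixed

variable {K : Type} [Field K] {p : ℕ} [hp : Fact p.Prime] [CharP K p]

/-! ## §1 The chart polynomial `G` -/

omit hp [CharP K p] in
/-- `G` as a sum of five monomials. [folklore] -/
theorem G_mixed_eq_monomial_add :
    (X 1 ^ (2 * p) * X 2 - X 1 ^ p * X 2 + X 1 ^ p * X 2 ^ p * X 3 + X 0 * X 1 ^ p * X 3 ^ p + X 0 ^ p * X 1 :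
        MvPolynomial (Fin 4) K) =
      monomial (Finsupp.single 1 (2 * p) + Finsupp.single 2 1) 1 + monomial (Finsupp.single 1 p + Finsupp.single 2 1) (-1) +
        monomial (Finsupp.single 1 p + Finsupp.single 2 p + Finsupp.single 3 1) 1 +
        monomial (Finsupp.single 0 1 + Finsupp.single 1 p + Finsupp.single 3 p) 1 +
        monomial (Finsupp.single 0 p + Finsupp.single 1 1) 1 := by
  have h1 : (X 1 ^ (2 * p) * X 2 : MvPolynomial (Fin 4) K) = monomial (Finsupp.single 1 (2 * p) + Finsupp.single 2 1) 1 := by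
    rw [X_pow_eq_monomial, X, monomial_mul, mul_one]
  have h3 : (X 1 ^ p * X 2 ^ p * X 3 : MvPolynomial (Fin 4) K) =
      monomial (Finsupp.single 1 p + Finsupp.single 2 p + Finsupp.single 3 1) 1 := by
    rw [X_pow_eq_monomial, X_pow_eq_monomial, X, monomial_mul, monomial_mul, mul_one, mul_one]
  have h4 : (X 0 * X 1 ^ p * X 3 ^ p : MvPolynomial (Fin 4) K) =
      monomial (Finsupp.single 0 1 + Finsupp.single 1 p + Finsupp.single 3 p) 1 := by
    rw [X_pow_eq_monomial, X_pow_eq_monomial, X, monomial_mul, monomial_mul, mul_one, mul_one]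
  rw [h1, X_pow_mul_X_eq_monomial, h3, h4, X_pow_mul_X_eq_monomial, map_neg, ← sub_eq_add_neg]

omit hp [CharP K p] in
/-- The support of `G` lies in its five exponents. [folklore] -/
theorem mem_support_G_mixed {d : Fin 4 →₀ ℕ}
    (hd : d ∈ (X 1 ^ (2 * p) * X 2 - X 1 ^ p * X 2 + X 1 ^ p * X 2 ^ p * X 3 + X 0 * X 1 ^ p * X 3 ^ p + X 0 ^ p * X 1 :
      MvPolynomial (Fin 4) K).support) :
    d = Finsupp.single 1 (2 * p) + Finsupp.single 2 1 ∨ d = Finsupp.single 1 p + Finsupp.single 2 1 ∨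
      d = Finsupp.single 1 p + Finsupp.single 2 p + Finsupp.single 3 1 ∨
      d = Finsupp.single 0 1 + Finsupp.single 1 p + Finsupp.single 3 p ∨ d = Finsupp.single 0 p + Finsupp.single 1 1 := by
  rw [G_mixed_eq_monomial_add] at hd
  rcases Finset.mem_union.mp (Finset.mem_of_subset MvPolynomial.support_add hd) with h₁ | h₁
  · rcases Finset.mem_union.mp (Finset.mem_of_subset MvPolynomial.support_add h₁) with h₂ | h₂
    · rcases Finset.mem_union.mp (Finset.mem_of_subset MvPolynomial.support_add h₂) with h₃ | h₃
      · rcases Finset.mem_union.mp (Finset.mem_of_subset MvPolynomial.support_add h₃) with h₄ | h₄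
        · exact Or.inl (Finset.mem_singleton.mp (Finset.mem_of_subset support_monomial_subset h₄))
        · exact Or.inr (Or.inl (Finset.mem_singleton.mp (Finset.mem_of_subset support_monomial_subset h₄)))
      · exact Or.inr (Or.inr (Or.inl (Finset.mem_singleton.mp (Finset.mem_of_subset support_monomial_subset h₃))))
    · exact Or.inr (Or.inr (Or.inr (Or.inl (Finset.mem_singleton.mp (Finset.mem_of_subset support_monomial_subset h₂)))))
  · exact Or.inr (Or.inr (Or.inr (Or.inr (Finset.mem_singleton.mp (Finset.mem_of_subset support_monomial_subset h₁)))))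

omit [CharP K p] in
/-- `G` is clean (every monomial has an exponent `1`). [cite: HauserPerlega2019PRIMS, §2 (cleaning)] -/
theorem isClean_G_mixed :
    Literature.Barriers.ResolutionOfSingularities.HauserPerlega.IsClean p
      (X 1 ^ (2 * p) * X 2 - X 1 ^ p * X 2 + X 1 ^ p * X 2 ^ p * X 3 + X 0 * X 1 ^ p * X 3 ^ p + X 0 ^ p * X 1 :
        MvPolynomial (Fin 4) K) := by
  intro d hd hpth
  have key : ∀ i : Fin 4, d i = 1 → False := fun i hi => by
    have h := hpth i (by rw [Finsupp.mem_support_iff, hi]; exact one_ne_zero)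
    rw [hi] at h
    exact hp.out.one_lt.ne' (Nat.dvd_one.mp h)
  rcases mem_support_G_mixed hd with rfl | rfl | rfl | rfl | rfl
  · exact key 2 (by simp)
  · exact key 2 (by simp)
  · exact key 3 (by simp)
  · exact key 0 (by simp)
  · exact key 1 (by simp)

omit [CharP K p] in
/-- Every monomial of `G` has total degree `≥ p + 1`. [folklore] -/
theorem le_degree_of_mem_support_G_mixed {d : Fin 4 →₀ ℕ}
    (hd : d ∈ (X 1 ^ (2 * p) * X 2 - X 1 ^ p * X 2 + X 1 ^ p * X 2 ^ p * X 3 + X 0 * X 1 ^ p * X 3 ^ p + X 0 ^ p * X 1 :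
      MvPolynomial (Fin 4) K).support) :
    p + 1 ≤ d.degree := by
  have := hp.out.one_le
  rcases mem_support_G_mixed hd with rfl | rfl | rfl | rfl | rfl <;>
    simp only [map_add, Finsupp.degree_single] <;> omega

omit hp [CharP K p] in
/-- **`V(z, y₁, y₂)` is Hironaka-permissible for `z^p + G`** (every monomial has `y₁`-plus-`y₂`-degree `≥ p`).
[cite: HauserPerlega2019PRIMS, §2 (condition (1))] -/
theorem isPermissibleCentre_pair_G_mixed :
    IsPermissibleCentre p ({0, 1} : Finset (Fin 4))
      (X 1 ^ (2 * p) * X 2 - X 1 ^ p * X 2 + X 1 ^ p * X 2 ^ p * X 3 + X 0 * X 1 ^ p * X 3 ^ p + X 0 ^ p * X 1 :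
        MvPolynomial (Fin 4) K) := by
  refine ⟨⟨0, Finset.mem_insert_self _ _⟩, Finset.le_inf fun d hd => ?_⟩
  rcases mem_support_G_mixed hd with rfl | rfl | rfl | rfl | rfl <;> simp [degIn_pair]
  exact_mod_cast (by omega)

/-! ## §2 The root equation `F = x₁^p · G` and the member `(0, {x₁})` -/

omit hp [CharP K p] in
/-- `F = x₁^p · G` as a sum of five monomials. [folklore] -/
theorem F_mixed_eq_monomial_add :
    (X 0 ^ p * (X 1 ^ (2 * p) * X 2 - X 1 ^ p * X 2 + X 1 ^ p * X 2 ^ p * X 3 + X 0 * X 1 ^ p * X 3 ^ p + X 0 ^ p * X 1) :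
        MvPolynomial (Fin 4) K) =
      monomial (Finsupp.single 0 p + (Finsupp.single 1 (2 * p) + Finsupp.single 2 1)) 1 +
        monomial (Finsupp.single 0 p + (Finsupp.single 1 p + Finsupp.single 2 1)) (-1) +
        monomial (Finsupp.single 0 p + (Finsupp.single 1 p + Finsupp.single 2 p + Finsupp.single 3 1)) 1 +
        monomial (Finsupp.single 0 p + (Finsupp.single 0 1 + Finsupp.single 1 p + Finsupp.single 3 p)) 1 +
        monomial (Finsupp.single 0 p + (Finsupp.single 0 p + Finsupp.single 1 1)) 1 := by
  rw [G_mixed_eq_monomial_add, X_pow_eq_monomial, mul_add, mul_add, mul_add, mul_add, monomial_mul, monomial_mul, monomial_mul,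
    monomial_mul, monomial_mul, mul_one, one_mul]

omit hp [CharP K p] in
/-- The support of `F` lies in its five exponents. [folklore] -/
theorem mem_support_F_mixed {d : Fin 4 →₀ ℕ}
    (hd : d ∈ (X 0 ^ p * (X 1 ^ (2 * p) * X 2 - X 1 ^ p * X 2 + X 1 ^ p * X 2 ^ p * X 3 + X 0 * X 1 ^ p * X 3 ^ p + X 0 ^ p * X 1) :
      MvPolynomial (Fin 4) K).support) :
    d = Finsupp.single 0 p + (Finsupp.single 1 (2 * p) + Finsupp.single 2 1) ∨
      d = Finsupp.single 0 p + (Finsupp.single 1 p + Finsupp.single 2 1) ∨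
      d = Finsupp.single 0 p + (Finsupp.single 1 p + Finsupp.single 2 p + Finsupp.single 3 1) ∨
      d = Finsupp.single 0 p + (Finsupp.single 0 1 + Finsupp.single 1 p + Finsupp.single 3 p) ∨
      d = Finsupp.single 0 p + (Finsupp.single 0 p + Finsupp.single 1 1) := by
  rw [F_mixed_eq_monomial_add] at hd
  rcases Finset.mem_union.mp (Finset.mem_of_subset MvPolynomial.support_add hd) with h₁ | h₁
  · rcases Finset.mem_union.mp (Finset.mem_of_subset MvPolynomial.support_add h₁) with h₂ | h₂
    · rcases Finset.mem_union.mp (Finset.mem_of_subset MvPolynomial.support_add h₂) with h₃ | h₃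
      · rcases Finset.mem_union.mp (Finset.mem_of_subset MvPolynomial.support_add h₃) with h₄ | h₄
        · exact Or.inl (Finset.mem_singleton.mp (Finset.mem_of_subset support_monomial_subset h₄))
        · exact Or.inr (Or.inl (Finset.mem_singleton.mp (Finset.mem_of_subset support_monomial_subset h₄)))
      · exact Or.inr (Or.inr (Or.inl (Finset.mem_singleton.mp (Finset.mem_of_subset support_monomial_subset h₃))))
    · exact Or.inr (Or.inr (Or.inr (Or.inl (Finset.mem_singleton.mp (Finset.mem_of_subset support_monomial_subset h₂)))))
  · exact Or.inr (Or.inr (Or.inr (Or.inr (Finset.mem_singleton.mp (Finset.mem_of_subset support_monomial_subset h₁)))))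

omit [CharP K p] in
/-- `F` is clean. [cite: HauserPerlega2019PRIMS, §2 (cleaning)] -/
theorem isClean_F_mixed :
    Literature.Barriers.ResolutionOfSingularities.HauserPerlega.IsClean p
      (X 0 ^ p * (X 1 ^ (2 * p) * X 2 - X 1 ^ p * X 2 + X 1 ^ p * X 2 ^ p * X 3 + X 0 * X 1 ^ p * X 3 ^ p + X 0 ^ p * X 1) :
        MvPolynomial (Fin 4) K) := by
  intro d hd hpth
  have hp1 : ¬ p ∣ 1 := fun h => hp.out.one_lt.ne' (Nat.dvd_one.mp h)
  have key : ∀ i : Fin 4, d i = 1 → False := fun i hi => by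
    have h := hpth i (by rw [Finsupp.mem_support_iff, hi]; exact one_ne_zero)
    rw [hi] at h
    exact hp1 h
  rcases mem_support_F_mixed hd with rfl | rfl | rfl | rfl | rfl
  · exact key 2 (by simp)
  · exact key 2 (by simp)
  · exact key 3 (by simp)
  · have h0 : (Finsupp.single 0 p + (Finsupp.single 0 1 + Finsupp.single 1 p + Finsupp.single 3 p) : Fin 4 →₀ ℕ) 0 = p + 1 := by
      simp
    have h := hpth 0 (by rw [Finsupp.mem_support_iff, h0]; omega)
    rw [h0] at h
    exact hp1 ((Nat.dvd_add_right (dvd_refl p)).mp h)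
  · exact key 1 (by simp)

omit [CharP K p] in
/-- `F ≠ 0` (the coefficient of `x₁^{2p} x₂` is `1`). [folklore] -/
theorem F_mixed_ne_zero :
    (X 0 ^ p * (X 1 ^ (2 * p) * X 2 - X 1 ^ p * X 2 + X 1 ^ p * X 2 ^ p * X 3 + X 0 * X 1 ^ p * X 3 ^ p + X 0 ^ p * X 1) :
      MvPolynomial (Fin 4) K) ≠ 0 := by
  have hp0 : p ≠ 0 := hp.out.ne_zero
  intro h
  have hc := congrArg (coeff (Finsupp.single (0 : Fin 4) p + (Finsupp.single 0 p + Finsupp.single 1 1))) h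
  have n1 : (Finsupp.single (0 : Fin 4) p + (Finsupp.single 1 (2 * p) + Finsupp.single 2 1)) ≠
      Finsupp.single 0 p + (Finsupp.single 0 p + Finsupp.single 1 1) := fun h' => by
    have := DFunLike.congr_fun h' 2; simp at this
  have n2 : (Finsupp.single (0 : Fin 4) p + (Finsupp.single 1 p + Finsupp.single 2 1)) ≠
      Finsupp.single 0 p + (Finsupp.single 0 p + Finsupp.single 1 1) := fun h' => by
    have := DFunLike.congr_fun h' 2; simp at this
  have n3 : (Finsupp.single (0 : Fin 4) p + (Finsupp.single 1 p + Finsupp.single 2 p + Finsupp.single 3 1)) ≠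
      Finsupp.single 0 p + (Finsupp.single 0 p + Finsupp.single 1 1) := fun h' => by
    have := DFunLike.congr_fun h' 3; simp at this
  have n4 : (Finsupp.single (0 : Fin 4) p + (Finsupp.single 0 1 + Finsupp.single 1 p + Finsupp.single 3 p)) ≠
      Finsupp.single 0 p + (Finsupp.single 0 p + Finsupp.single 1 1) := fun h' => by
    have := DFunLike.congr_fun h' 3; simp at this; exact hp0 this
  rw [F_mixed_eq_monomial_add, coeff_add, coeff_add, coeff_add, coeff_add, coeff_monomial, if_neg n1, coeff_monomial, if_neg n2,
    coeff_monomial, if_neg n3, coeff_monomial, if_neg n4, coeff_monomial, if_pos rfl, coeff_zero] at hc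
  simp at hc

omit hp [CharP K p] in
/-- **`V(z, x₁)` is Hironaka-permissible for `z^p + F`.** [cite: HauserPerlega2019PRIMS, §2 (condition (1))] -/
theorem isPermissibleCentre_F_mixed :
    IsPermissibleCentre p ({0} : Finset (Fin 4))
      (X 0 ^ p * (X 1 ^ (2 * p) * X 2 - X 1 ^ p * X 2 + X 1 ^ p * X 2 ^ p * X 3 + X 0 * X 1 ^ p * X 3 ^ p + X 0 ^ p * X 1) :
        MvPolynomial (Fin 4) K) := by
  refine ⟨⟨0, Finset.mem_singleton_self _⟩, Finset.le_inf fun d hd => ?_⟩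
  rcases mem_support_F_mixed hd with rfl | rfl | rfl | rfl | rfl <;> simp [degIn_singleton_zero]

omit hp [CharP K p] in
/-- **The `x₁`-chart transform of `F` is `G`** (division by `x₁^p`). [cite: HauserPerlega2019PRIMS, §2 (the x₁-chart)] -/
theorem chartTransform_F_mixed :
    CentreBlowup.chartTransform p ({0} : Finset (Fin 4)) 0
        (X 0 ^ p * (X 1 ^ (2 * p) * X 2 - X 1 ^ p * X 2 + X 1 ^ p * X 2 ^ p * X 3 + X 0 * X 1 ^ p * X 3 ^ p + X 0 ^ p * X 1) :
          MvPolynomial (Fin 4) K) =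
      X 1 ^ (2 * p) * X 2 - X 1 ^ p * X 2 + X 1 ^ p * X 2 ^ p * X 3 + X 0 * X 1 ^ p * X 3 ^ p + X 0 ^ p * X 1 := by
  rw [F_mixed_eq_monomial_add, CentreBlowup.chartTransform_add, CentreBlowup.chartTransform_add, CentreBlowup.chartTransform_add,
    CentreBlowup.chartTransform_monomial_add_monomial, CentreBlowup.chartTransform_monomial, CentreBlowup.chartTransform_monomial,
    CentreBlowup.chartTransform_monomial]
  simp only [CentreBlowup.chartExponent, degIn_singleton_zero]
  have e1 : (Finsupp.single 0 p + (Finsupp.single 1 (2 * p) + Finsupp.single 2 1) : Fin 4 →₀ ℕ).update 0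
      ((Finsupp.single 0 p + (Finsupp.single 1 (2 * p) + Finsupp.single 2 1) : Fin 4 →₀ ℕ) 0 - p) =
        Finsupp.single 1 (2 * p) + Finsupp.single 2 1 := by
    ext i; fin_cases i <;> simp [Finsupp.update_apply]
  have e2 : (Finsupp.single 0 p + (Finsupp.single 1 p + Finsupp.single 2 1) : Fin 4 →₀ ℕ).update 0
      ((Finsupp.single 0 p + (Finsupp.single 1 p + Finsupp.single 2 1) : Fin 4 →₀ ℕ) 0 - p) =
        Finsupp.single 1 p + Finsupp.single 2 1 := by
    ext i; fin_cases i <;> simp [Finsupp.update_apply]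
  have e3 : (Finsupp.single 0 p + (Finsupp.single 1 p + Finsupp.single 2 p + Finsupp.single 3 1) : Fin 4 →₀ ℕ).update 0
      ((Finsupp.single 0 p + (Finsupp.single 1 p + Finsupp.single 2 p + Finsupp.single 3 1) : Fin 4 →₀ ℕ) 0 - p) =
        Finsupp.single 1 p + Finsupp.single 2 p + Finsupp.single 3 1 := by
    ext i; fin_cases i <;> simp [Finsupp.update_apply]
  have e4 : (Finsupp.single 0 p + (Finsupp.single 0 1 + Finsupp.single 1 p + Finsupp.single 3 p) : Fin 4 →₀ ℕ).update 0
      ((Finsupp.single 0 p + (Finsupp.single 0 1 + Finsupp.single 1 p + Finsupp.single 3 p) : Fin 4 →₀ ℕ) 0 - p) =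
        Finsupp.single 0 1 + Finsupp.single 1 p + Finsupp.single 3 p := by
    ext i; fin_cases i <;> simp [Finsupp.update_apply]
  have e5 : (Finsupp.single 0 p + (Finsupp.single 0 p + Finsupp.single 1 1) : Fin 4 →₀ ℕ).update 0
      ((Finsupp.single 0 p + (Finsupp.single 0 p + Finsupp.single 1 1) : Fin 4 →₀ ℕ) 0 - p) =
        Finsupp.single 0 p + Finsupp.single 1 1 := by
    ext i; fin_cases i <;> simp [Finsupp.update_apply]
  rw [e1, e2, e3, e4, e5, G_mixed_eq_monomial_add]

/-- **The root parameters lie on the member**: order `p` at `(a, b)` forces `b₁ = 0` (`∂F/∂x₂ = x₁^{2p}`).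
[cite: Hauser2010, §F (equiconstant points)] -/
theorem roots_F_mixed (b : Fin 4 → K)
    (H : ∀ d : Fin 4 →₀ ℕ, d ≠ 0 → d.degree < p → coeff d (PointBlowup.translate b
      (X 0 ^ p * (X 1 ^ (2 * p) * X 2 - X 1 ^ p * X 2 + X 1 ^ p * X 2 ^ p * X 3 + X 0 * X 1 ^ p * X 3 ^ p + X 0 ^ p * X 1) :
        MvPolynomial (Fin 4) K)) = 0) :
    b 0 = 0 := by
  have h1 := eval_pderiv_eq_zero_of_forall_coeff b _ H 1
  simp [(pderiv (1 : Fin 4)).leibniz_pow, hp.out.ne_zero] at h1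
  exact h1

omit [CharP K p] in
/-- **The `F`-component of the child state** `step p {x₁} x₁ 0 (F, 0, ∅)` is `G`. [cite: Hauser2010, §§F–G] -/
theorem step_F_mixed_zero [DecidableEq K] :
    (CentreBlowup.step p ({0} : Finset (Fin 4)) 0 0
        (⟨X 0 ^ p * (X 1 ^ (2 * p) * X 2 - X 1 ^ p * X 2 + X 1 ^ p * X 2 ^ p * X 3 + X 0 * X 1 ^ p * X 3 ^ p + X 0 ^ p * X 1), 0, ∅⟩ :
          State K)).F =
      X 1 ^ (2 * p) * X 2 - X 1 ^ p * X 2 + X 1 ^ p * X 2 ^ p * X 3 + X 0 * X 1 ^ p * X 3 ^ p + X 0 ^ p * X 1 := by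
  show deletePthPowers p (PointBlowup.translate 0 (CentreBlowup.chartTransform p ({0} : Finset (Fin 4)) 0
    (X 0 ^ p * (X 1 ^ (2 * p) * X 2 - X 1 ^ p * X 2 + X 1 ^ p * X 2 ^ p * X 3 + X 0 * X 1 ^ p * X 3 ^ p + X 0 ^ p * X 1) :
      MvPolynomial (Fin 4) K))) = _
  rw [chartTransform_F_mixed, PointBlowup.translate_zero]
  exact Literature.Barriers.ResolutionOfSingularities.HauserPerlega.deletePthPowers_eq_self isClean_G_mixed

omit [CharP K p] in
/-- **The origin of the `x₁`-chart is an equimultiple pair** (`G` has no monomial of degree `< p`).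
[cite: Hauser2010, §F (equiconstant points)] -/
theorem isEquimultiplePoint_F_mixed_origin [DecidableEq K] :
    CentreBlowup.IsEquimultiplePoint p ({0} : Finset (Fin 4)) 0 0
      (⟨X 0 ^ p * (X 1 ^ (2 * p) * X 2 - X 1 ^ p * X 2 + X 1 ^ p * X 2 ^ p * X 3 + X 0 * X 1 ^ p * X 3 ^ p + X 0 ^ p * X 1), 0, ∅⟩ :
        State K) := by
  intro d hd hdp
  unfold CentreBlowup.pointTransform
  rw [show (⟨X 0 ^ p * (X 1 ^ (2 * p) * X 2 - X 1 ^ p * X 2 + X 1 ^ p * X 2 ^ p * X 3 + X 0 * X 1 ^ p * X 3 ^ p + X 0 ^ p * X 1), 0, ∅⟩ :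
      State K).F = X 0 ^ p * (X 1 ^ (2 * p) * X 2 - X 1 ^ p * X 2 + X 1 ^ p * X 2 ^ p * X 3 + X 0 * X 1 ^ p * X 3 ^ p + X 0 ^ p * X 1)
      from rfl, chartTransform_F_mixed, PointBlowup.translate_zero]
  by_contra hne
  have := le_degree_of_mem_support_G_mixed (MvPolynomial.mem_support_iff.mpr hne)
  omega

/-- **THE EQUIMULTIPLE POINTS OF THE `x₁`-CHART LIE ON `{y₂ = 0}` OR AT `(0, 1, 0, 0)`**
(`∂G/∂x₃ = (x₂² − x₂)^p`, `∂G/∂x₄ = (x₂x₃)^p`, `∂G/∂x₁ = (x₂x₄)^p`). [cite: Hauser2010, §F (equiconstant points)] -/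
theorem cases_of_isEquimultiplePoint_F_mixed [DecidableEq K] {b : Fin 4 → K} (hb0 : b 0 = 0)
    (h : CentreBlowup.IsEquimultiplePoint p ({0} : Finset (Fin 4)) 0 b
      (⟨X 0 ^ p * (X 1 ^ (2 * p) * X 2 - X 1 ^ p * X 2 + X 1 ^ p * X 2 ^ p * X 3 + X 0 * X 1 ^ p * X 3 ^ p + X 0 ^ p * X 1), 0, ∅⟩ :
        State K)) :
    b 1 = 0 ∨ b = Pi.single 1 1 := by
  unfold CentreBlowup.IsEquimultiplePoint CentreBlowup.pointTransform at h
  rw [show (⟨X 0 ^ p * (X 1 ^ (2 * p) * X 2 - X 1 ^ p * X 2 + X 1 ^ p * X 2 ^ p * X 3 + X 0 * X 1 ^ p * X 3 ^ p + X 0 ^ p * X 1), 0, ∅⟩ :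
      State K).F = X 0 ^ p * (X 1 ^ (2 * p) * X 2 - X 1 ^ p * X 2 + X 1 ^ p * X 2 ^ p * X 3 + X 0 * X 1 ^ p * X 3 ^ p + X 0 ^ p * X 1)
      from rfl, chartTransform_F_mixed] at h
  have h0 := eval_pderiv_eq_zero_of_forall_coeff b _ h 0
  have h2 := eval_pderiv_eq_zero_of_forall_coeff b _ h 2
  have h3 := eval_pderiv_eq_zero_of_forall_coeff b _ h 3
  simp [(pderiv (0 : Fin 4)).leibniz_pow, (pderiv (2 : Fin 4)).leibniz_pow, (pderiv (3 : Fin 4)).leibniz_pow,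
    hp.out.ne_zero] at h0 h2 h3
  by_cases hb1 : b 1 = 0
  · exact Or.inl hb1
  · right
    -- `(b₂² − b₂)^p = 0`
    have hsq : (b 1 * b 1 - b 1) ^ p = 0 := by
      rw [sub_pow_char, mul_pow, ← pow_two, ← pow_mul, mul_comm p 2]
      exact h2
    have hb1' : b 1 = 1 := by
      have := pow_eq_zero_iff (hp.out.ne_zero) |>.mp hsq
      have h' : b 1 * (b 1 - 1) = 0 := by rw [mul_sub, mul_one]; exact this
      rcases mul_eq_zero.mp h' with h'' | h''
      · exact absurd h'' hb1
      · exact sub_eq_zero.mp h''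
    rcases h3 with h3 | h3
    · exact absurd h3 hb1
    rcases h0 with h0 | h0
    swap
    · exact absurd h0 hb1
    funext i
    obtain rfl | rfl | rfl | rfl : i = 0 ∨ i = 1 ∨ i = 2 ∨ i = 3 := by fin_cases i <;> simp
    · simpa using hb0
    · simpa using hb1'
    · simpa using h3
    · simpa using h0

end Mixed

end Equimultiple

end Summit.ResolutionOfSingularities.ResolutionOfSingularities.Theorems.PIDim4

end
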